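import Mathlib
import Summits.Ventures.PercRepro.TriangleCapTwoTrianglesEightA

/-!
# PercRepro — THE REFINED FAR COUNT AROUND TWO TRIANGLES, PART B: the four blocks and the count
(p3, gen 37; part 56)

With `S = T₁ ∪ T₂` (two three-cliques sharing at most one vertex), `Q = adjPairs D S`, `degIn S x = |N(x) ∩ S|`
and `W(z) = Σ_{x ∈ N(z) ∩ S} degIn S x`:

* `block_clique` — the ordered pairs of a triangle `T ⊆ S` pay `6 (|S| + 1) − 4 Σ_{x ∈ T} degIn S x` to the
  vertices of `S`;
* `block_cross` / `block_cross_swap` — the pairs between `S` and `Sᶜ` pay `|S| Σ_{z ∉ S} degIn S z − Σ_{z ∉ S} W(z)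
  − Σ_{z ∉ S} (degIn S z)²` in each orientation;
* `block_outside` — the pairs inside `Sᶜ` pay `|S| Σ_{z ∉ S} degIn Sᶜ z − 2 Σ_{z ∉ S} degIn S z · degIn Sᶜ z`;
* **`two_triangles_far_count`** — with `Q ≤ far(z) + 2 W(z)` for the vertices off `S` (TriangleCapTwoTrianglesEightA):
  `Σ_p deficit(p) + 4 Σ_{T₁} degIn S + 4 Σ_{T₂} degIn S + 4 Σ_{z ∉ S} W(z) + 2 Σ_{z ∉ S} (degIn S z)² +
  2 Σ_{z ∉ S} degIn S z · degIn Sᶜ z ≥ |Sᶜ| Q + 12 (|S| + 1) + 2 |S| Σ_{z ∉ S} degIn S z + |S| Σ_{z ∉ S} degIn Sᶜ z`.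
Parts C and D specialise it to vertex-disjoint triangles and to triangles sharing a vertex.
Axioms: standard.
-/

namespace PercRepro

namespace TriangleCap

namespace C047

open Finset

variable {V : Type*} [Fintype V] [DecidableEq V]

omit [Fintype V] in
/-- **THE TRIANGLE BLOCK:** for a three-clique `T ⊆ S`, `6 (|S| + 1) ≤ Σ_{(x, y) ∈ T × T adjacent}
|S ∖ (N(x) ∪ N(y))| + 4 Σ_{x ∈ T} degIn S x`. -/
theorem block_clique (D : SimpleGraph V) [DecidableRel D.Adj] (S T : Finset V) (hT : T.card = 3) (hTS : T ⊆ S)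
    (hcl : ∀ x ∈ T, ∀ y ∈ T, x ≠ y → D.Adj x y) :
    6 * (S.card + 1) ≤
      (∑ x ∈ T, ∑ y ∈ T, if D.Adj x y then (S.filter (fun t => ¬ D.Adj x t ∧ ¬ D.Adj y t)).card else 0) +
      4 * ∑ x ∈ T, degIn D S x := by
  -- pointwise: each adjacent ordered pair of `T` pays `|S| + 1` together with its two degrees
  have hpt : ∀ x ∈ T, ∀ y ∈ T, (if D.Adj x y then S.card + 1 else 0) ≤
      (if D.Adj x y then (S.filter (fun t => ¬ D.Adj x t ∧ ¬ D.Adj y t)).card else 0) +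
      (if D.Adj x y then degIn D S x else 0) + (if D.Adj x y then degIn D S y else 0) := by
    intro x hx y hy
    by_cases hxy : D.Adj x y
    · simp only [hxy, if_true]
      obtain ⟨t, ht, htx, hty⟩ := exists_third_of_clique D hT hcl hx hy hxy.ne
      exact card_add_one_le_card_far_add D S (hTS ht) htx hty
    · simp [hxy]
  have hsum : (∑ x ∈ T, ∑ y ∈ T, if D.Adj x y then S.card + 1 else 0) ≤
      (∑ x ∈ T, ∑ y ∈ T, if D.Adj x y then (S.filter (fun t => ¬ D.Adj x t ∧ ¬ D.Adj y t)).card else 0) +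
      (∑ x ∈ T, ∑ y ∈ T, if D.Adj x y then degIn D S x else 0) +
      (∑ x ∈ T, ∑ y ∈ T, if D.Adj x y then degIn D S y else 0) := by
    rw [← sum_add_distrib, ← sum_add_distrib]
    apply sum_le_sum
    intro x hx
    rw [← sum_add_distrib, ← sum_add_distrib]
    apply sum_le_sum
    intro y hy
    exact hpt x hx y hy
  -- the three sums
  have e1 : (∑ x ∈ T, ∑ y ∈ T, if D.Adj x y then S.card + 1 else 0) = 6 * (S.card + 1) := by
    rw [double_sum_ite_left]
    rw [sum_congr rfl (fun x hx => by rw [degIn_self_of_clique D hT hcl hx])]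
    rw [sum_const, hT, smul_eq_mul]
    ring
  have e2 : (∑ x ∈ T, ∑ y ∈ T, if D.Adj x y then degIn D S x else 0) = 2 * ∑ x ∈ T, degIn D S x := by
    rw [double_sum_ite_left, mul_sum]
    apply sum_congr rfl
    intro x hx
    rw [degIn_self_of_clique D hT hcl hx]
  have e3 : (∑ x ∈ T, ∑ y ∈ T, if D.Adj x y then degIn D S y else 0) = 2 * ∑ x ∈ T, degIn D S x := by
    rw [double_sum_ite_right, mul_sum]
    apply sum_congr rfl
    intro x hx
    rw [degIn_self_of_clique D hT hcl hx]
  omega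

/-- **THE CROSS BLOCK `S × Sᶜ`:** `|S| · Σ_{z ∉ S} degIn S z ≤ Σ_{(x, z) ∈ S × Sᶜ adjacent} |S ∖ (N(x) ∪ N(z))|
+ Σ_{z ∉ S} W(z) + Σ_{z ∉ S} (degIn S z)²`. -/
theorem block_cross (D : SimpleGraph V) [DecidableRel D.Adj] (S : Finset V) :
    S.card * ∑ z ∈ Sᶜ, degIn D S z ≤
      (∑ x ∈ S, ∑ z ∈ Sᶜ, if D.Adj x z then (S.filter (fun t => ¬ D.Adj x t ∧ ¬ D.Adj z t)).card else 0) +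
      (∑ z ∈ Sᶜ, ∑ x ∈ S.filter (fun x => D.Adj z x), degIn D S x) +
      ∑ z ∈ Sᶜ, degIn D S z * degIn D S z := by
  have hsum : (∑ x ∈ S, ∑ z ∈ Sᶜ, if D.Adj x z then S.card else 0) ≤
      (∑ x ∈ S, ∑ z ∈ Sᶜ, if D.Adj x z then (S.filter (fun t => ¬ D.Adj x t ∧ ¬ D.Adj z t)).card else 0) +
      (∑ x ∈ S, ∑ z ∈ Sᶜ, if D.Adj x z then degIn D S x else 0) +
      (∑ x ∈ S, ∑ z ∈ Sᶜ, if D.Adj x z then degIn D S z else 0) := by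
    rw [← sum_add_distrib, ← sum_add_distrib]
    apply sum_le_sum
    intro x _
    rw [← sum_add_distrib, ← sum_add_distrib]
    apply sum_le_sum
    intro z _
    by_cases hxz : D.Adj x z
    · simp only [hxz, if_true]
      exact card_le_card_far_add D S x z
    · simp [hxz]
  have e1 : (∑ x ∈ S, ∑ z ∈ Sᶜ, if D.Adj x z then S.card else 0) = S.card * ∑ z ∈ Sᶜ, degIn D S z := by
    rw [double_sum_ite_right, mul_sum]
    apply sum_congr rfl
    intro z _
    ring
  have e2 : (∑ x ∈ S, ∑ z ∈ Sᶜ, if D.Adj x z then degIn D S x else 0) =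
      ∑ z ∈ Sᶜ, ∑ x ∈ S.filter (fun x => D.Adj z x), degIn D S x := by
    rw [double_sum_ite_swap]
  have e3 : (∑ x ∈ S, ∑ z ∈ Sᶜ, if D.Adj x z then degIn D S z else 0) =
      ∑ z ∈ Sᶜ, degIn D S z * degIn D S z := by
    rw [double_sum_ite_right]
  omega

/-- The block `Sᶜ × S` equals the block `S × Sᶜ` (the far set of a pair is symmetric). -/
theorem block_cross_swap (D : SimpleGraph V) [DecidableRel D.Adj] (S : Finset V) :
    (∑ z ∈ Sᶜ, ∑ x ∈ S, if D.Adj z x then (S.filter (fun t => ¬ D.Adj z t ∧ ¬ D.Adj x t)).card else 0) =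
      ∑ x ∈ S, ∑ z ∈ Sᶜ, if D.Adj x z then (S.filter (fun t => ¬ D.Adj x t ∧ ¬ D.Adj z t)).card else 0 := by
  rw [sum_comm]
  apply sum_congr rfl
  intro x _
  apply sum_congr rfl
  intro z _
  have h1 : D.Adj z x ↔ D.Adj x z := D.adj_comm z x
  have h2 : S.filter (fun t => ¬ D.Adj z t ∧ ¬ D.Adj x t) = S.filter (fun t => ¬ D.Adj x t ∧ ¬ D.Adj z t) := by
    apply filter_congr
    intro t _
    exact and_comm
  rw [h2]
  by_cases h : D.Adj x z
  · simp only [h, h1.mpr h, if_true]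
  · simp only [h, h1, if_false]

/-- **THE OUTSIDE BLOCK `Sᶜ × Sᶜ`:** `|S| · Σ_{z ∉ S} degIn Sᶜ z ≤ Σ_{(z, z') ∈ Sᶜ × Sᶜ adjacent}
|S ∖ (N(z) ∪ N(z'))| + 2 Σ_{z ∉ S} degIn S z · degIn Sᶜ z`. -/
theorem block_outside (D : SimpleGraph V) [DecidableRel D.Adj] (S : Finset V) :
    S.card * ∑ z ∈ Sᶜ, degIn D Sᶜ z ≤
      (∑ z ∈ Sᶜ, ∑ z' ∈ Sᶜ, if D.Adj z z' then (S.filter (fun t => ¬ D.Adj z t ∧ ¬ D.Adj z' t)).card else 0) +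
      2 * ∑ z ∈ Sᶜ, degIn D S z * degIn D Sᶜ z := by
  have hsum : (∑ z ∈ Sᶜ, ∑ z' ∈ Sᶜ, if D.Adj z z' then S.card else 0) ≤
      (∑ z ∈ Sᶜ, ∑ z' ∈ Sᶜ, if D.Adj z z' then (S.filter (fun t => ¬ D.Adj z t ∧ ¬ D.Adj z' t)).card else 0) +
      (∑ z ∈ Sᶜ, ∑ z' ∈ Sᶜ, if D.Adj z z' then degIn D S z else 0) +
      (∑ z ∈ Sᶜ, ∑ z' ∈ Sᶜ, if D.Adj z z' then degIn D S z' else 0) := by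
    rw [← sum_add_distrib, ← sum_add_distrib]
    apply sum_le_sum
    intro z _
    rw [← sum_add_distrib, ← sum_add_distrib]
    apply sum_le_sum
    intro z' _
    by_cases h : D.Adj z z'
    · simp only [h, if_true]
      exact card_le_card_far_add D S z z'
    · simp [h]
  have e1 : (∑ z ∈ Sᶜ, ∑ z' ∈ Sᶜ, if D.Adj z z' then S.card else 0) = S.card * ∑ z ∈ Sᶜ, degIn D Sᶜ z := by
    rw [double_sum_ite_left, mul_sum]
    apply sum_congr rfl
    intro z _
    ring
  have e2 : (∑ z ∈ Sᶜ, ∑ z' ∈ Sᶜ, if D.Adj z z' then degIn D S z else 0) =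
      ∑ z ∈ Sᶜ, degIn D S z * degIn D Sᶜ z := by
    rw [double_sum_ite_left]
    apply sum_congr rfl
    intro z _
    ring
  have e3 : (∑ z ∈ Sᶜ, ∑ z' ∈ Sᶜ, if D.Adj z z' then degIn D S z' else 0) =
      ∑ z ∈ Sᶜ, degIn D S z * degIn D Sᶜ z := by
    rw [double_sum_ite_right]
    apply sum_congr rfl
    intro z _
    ring
  omega

omit [Fintype V] in
/-- The block `S × S` dominates the two triangle blocks when the triangles share at most one vertex
(the overlap `(T₁ ∩ T₂) × (T₁ ∩ T₂)` consists of diagonal pairs, which are not adjacent). -/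
theorem block_inside_ge (D : SimpleGraph V) [DecidableRel D.Adj] (T₁ T₂ : Finset V)
    (hint : (T₁ ∩ T₂).card ≤ 1) (G : V → V → ℕ) :
    (∑ x ∈ T₁, ∑ y ∈ T₁, if D.Adj x y then G x y else 0) +
      (∑ x ∈ T₂, ∑ y ∈ T₂, if D.Adj x y then G x y else 0) ≤
      ∑ x ∈ T₁ ∪ T₂, ∑ y ∈ T₁ ∪ T₂, if D.Adj x y then G x y else 0 := by
  rw [← sum_product', ← sum_product', ← sum_product']
  have h1 := sum_union_inter (s₁ := T₁ ×ˢ T₁) (s₂ := T₂ ×ˢ T₂)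
    (f := fun p : V × V => if D.Adj p.1 p.2 then G p.1 p.2 else 0)
  have h2 : ∑ p ∈ (T₁ ×ˢ T₁) ∩ (T₂ ×ˢ T₂), (if D.Adj p.1 p.2 then G p.1 p.2 else 0) = 0 := by
    apply sum_eq_zero
    intro p hp
    rw [mem_inter, mem_product, mem_product] at hp
    have hp1 : p.1 ∈ T₁ ∩ T₂ := mem_inter.mpr ⟨hp.1.1, hp.2.1⟩
    have hp2 : p.2 ∈ T₁ ∩ T₂ := mem_inter.mpr ⟨hp.1.2, hp.2.2⟩
    have heq : p.1 = p.2 := card_le_one.mp hint p.1 hp1 p.2 hp2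
    simp only [heq, SimpleGraph.irrefl, if_false]
  have h3 : ∑ p ∈ (T₁ ×ˢ T₁) ∪ (T₂ ×ˢ T₂), (if D.Adj p.1 p.2 then G p.1 p.2 else 0) ≤
      ∑ p ∈ (T₁ ∪ T₂) ×ˢ (T₁ ∪ T₂), (if D.Adj p.1 p.2 then G p.1 p.2 else 0) := by
    apply sum_le_sum_of_subset_of_nonneg
    · intro p hp
      rw [mem_union, mem_product, mem_product] at hp
      rw [mem_product, mem_union, mem_union]
      rcases hp with hp | hp
      · exact ⟨Or.inl hp.1, Or.inl hp.2⟩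
      · exact ⟨Or.inr hp.1, Or.inr hp.2⟩
    · intro _ _ _
      exact Nat.zero_le _
  omega

/-- **THE REFINED FAR COUNT AROUND TWO TRIANGLES** (`S = T₁ ∪ T₂`, two three-cliques sharing at most one
vertex): `Σ_p deficit(p) + 4 Σ_{T₁} degIn S + 4 Σ_{T₂} degIn S + 4 Σ_{z ∉ S} W(z) + 2 Σ_{z ∉ S} (degIn S z)² +
2 Σ_{z ∉ S} degIn S z · degIn Sᶜ z ≥ |Sᶜ| · Q + 12 (|S| + 1) + 2 |S| Σ_{z ∉ S} degIn S z +
|S| Σ_{z ∉ S} degIn Sᶜ z`, with `Q = adjPairs D S` and `W(z) = Σ_{x ∈ N(z) ∩ S} degIn S x`. -/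
theorem two_triangles_far_count (D : SimpleGraph V) [DecidableRel D.Adj] (T₁ T₂ : Finset V)
    (h₁ : T₁.card = 3) (h₂ : T₂.card = 3) (hint : (T₁ ∩ T₂).card ≤ 1)
    (hcl₁ : ∀ x ∈ T₁, ∀ y ∈ T₁, x ≠ y → D.Adj x y) (hcl₂ : ∀ x ∈ T₂, ∀ y ∈ T₂, x ≠ y → D.Adj x y) :
    (T₁ ∪ T₂)ᶜ.card * adjPairs D (T₁ ∪ T₂) + 12 * ((T₁ ∪ T₂).card + 1) +
      2 * (T₁ ∪ T₂).card * ∑ z ∈ (T₁ ∪ T₂)ᶜ, degIn D (T₁ ∪ T₂) z +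
      (T₁ ∪ T₂).card * ∑ z ∈ (T₁ ∪ T₂)ᶜ, degIn D (T₁ ∪ T₂)ᶜ z ≤
    ∑ p ∈ adjPairsAll D, deficit D p + 4 * ∑ x ∈ T₁, degIn D (T₁ ∪ T₂) x +
      4 * ∑ x ∈ T₂, degIn D (T₁ ∪ T₂) x +
      4 * ∑ z ∈ (T₁ ∪ T₂)ᶜ, ∑ x ∈ (T₁ ∪ T₂).filter (fun x => D.Adj z x), degIn D (T₁ ∪ T₂) x +
      2 * ∑ z ∈ (T₁ ∪ T₂)ᶜ, degIn D (T₁ ∪ T₂) z * degIn D (T₁ ∪ T₂) z +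
      2 * ∑ z ∈ (T₁ ∪ T₂)ᶜ, degIn D (T₁ ∪ T₂) z * degIn D (T₁ ∪ T₂)ᶜ z := by
  set S := T₁ ∪ T₂ with hS
  -- the deficit sum is the far count, split over `S` and `Sᶜ`
  rw [sum_deficit_eq_sum_far, ← sum_add_sum_compl S]
  -- the outside vertices: `Q ≤ far(z) + 2 W(z)` summed
  have hR : Sᶜ.card * adjPairs D S ≤ ∑ z ∈ Sᶜ, far D z +
      2 * ∑ z ∈ Sᶜ, ∑ x ∈ S.filter (fun x => D.Adj z x), degIn D S x := by
    rw [mul_sum, ← sum_add_distrib]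
    have : Sᶜ.card * adjPairs D S = ∑ _z ∈ Sᶜ, adjPairs D S := by rw [sum_const, smul_eq_mul]
    rw [this]
    apply sum_le_sum
    intro z _
    exact adjPairs_le_far_add D S z
  -- the vertices of `S`: the four blocks
  have hSfar := sum_far_eq_double D S
  rw [double_sum_split S] at hSfar
  have hin := block_inside_ge D T₁ T₂ hint (fun x y => (S.filter (fun t => ¬ D.Adj x t ∧ ¬ D.Adj y t)).card)
  have hb1 := block_clique D S T₁ h₁ subset_union_left hcl₁
  have hb2 := block_clique D S T₂ h₂ subset_union_right hcl₂
  have hc := block_cross D S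
  have hcs := block_cross_swap D S
  have ho := block_outside D S
  rw [← hS] at hin
  linarith

end C047

end TriangleCap

end PercRepro
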